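import Summits.Ventures.DiscreteObjects.UnitDistance.SpectralUnitBall
import Summits.Ventures.DiscreteObjects.UnitDistance.TwoAdicSquares
import Mathlib.Tactic

/-!
# The 2-adic Hermitian reduction for the Moser field (cell `pub-namedobj`, target (U), seat udg g10)

Framing (verbatim for the cell): lottery ticket; floor = certified bounds/negative ranges.

Local core of THEOREM U1 (`χ(ℚ(√3,√11)²) = 4`, MOSER-FIELD.md of udg g2, steps (B)+(C), referee-signed
2026-08-20; in-ring half = Hubai 2018 / Dúcz 2026, kernel `colorable_four_of_moserRing`).  We work inside ANY
field `Ω` algebraic over `ℚ₂` equipped with `LocalData`: `I² = −1`, `s3² = 3`, and two `ℚ₂`-automorphisms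
`σ : I ↦ −I, s3 ↦ s3` and `τ : I ↦ I, s3 ↦ −s3` (they exist in an algebraic closure of `ℚ₂`, file
`MoserFieldPlane`).  With `‖·‖` the spectral norm (multiplicative, ultrametric, Galois-invariant; `SpectralUnitBall`):

* `spN_unitStep` — a "unit step" `u = X + I·Y` with `X, Y ∈ ℚ₂ ⊕ ℚ₂·s3` and `X² + Y² = 1` has `‖u‖ = 1`
  (`u·σu = X² + Y² = 1` and `‖σu‖ = ‖u‖`);
* `resid_unitStep_cube` — its residue `ū` satisfies `ū³ = 1`: `T = u + τu`, `N = u·τu` lie in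
  `(ℚ₂ ⊕ ℚ₂·I) ∩ {‖·‖ ≤ 1}`, whose residues are `0` or `1` (`resid_zero_or_one`, from `‖I − 1‖ < 1` and the
  `ℤ₂[i]`-lemma `norm_coeff_le_one`), so `ū² + T̄ū + 1 = 0` with `T̄ ∈ {0,1}` in characteristic `2`;
* `quartFixed` — the colour set `{x : x⁴ = x}` of the residue domain: contains the cube roots of unity, is closed
  under addition (Frobenius) and has at most four elements (`exists_finset_quartFixed`).

No residue field is ever identified; nothing here is literature.
-/

noncomputable section

namespace Summit.Ventures.DiscreteObjects.UnitDistance.MoserLocal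

open Spectral Polynomial

/-- The local data in a field `Ω ⊇ ℚ₂`: square roots `I` of `−1` and `s3` of `3`, and two `ℚ₂`-automorphisms,
`σ` (complex-conjugation type: `I ↦ −I`, fixes `s3`) and `τ` (`s3 ↦ −s3`, fixes `I`). -/
structure LocalData (Ω : Type*) [Field Ω] [Algebra ℚ_[2] Ω] where
  /-- a square root of `-1` -/
  I : Ω
  /-- a square root of `3` -/
  s3 : Ω
  /-- `I² = -1` -/
  hI : I ^ 2 = -1
  /-- `s3² = 3` -/
  hs3 : s3 ^ 2 = 3
  /-- the automorphism negating `I` and fixing `s3` -/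
  σ : Ω ≃ₐ[ℚ_[2]] Ω
  /-- the automorphism negating `s3` and fixing `I` -/
  τ : Ω ≃ₐ[ℚ_[2]] Ω
  /-- `σ I = -I` -/
  σI : σ I = -I
  /-- `σ s3 = s3` -/
  σs3 : σ s3 = s3
  /-- `τ I = I` -/
  τI : τ I = I
  /-- `τ s3 = -s3` -/
  τs3 : τ s3 = -s3

variable {Ω : Type*} [Field Ω] [Algebra ℚ_[2] Ω] [Algebra.IsAlgebraic ℚ_[2] Ω] (D : LocalData Ω)

omit [Algebra.IsAlgebraic ℚ_[2] Ω] in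
/-- `‖2‖ = 1/2` in `Ω`. -/
theorem spN_two : spN ℚ_[2] (2 : Ω) = 2⁻¹ := by
  have h : (2 : Ω) = (algebraMap ℚ_[2] Ω) 2 := (map_ofNat (algebraMap ℚ_[2] Ω) 2).symm
  rw [h, spN_algebraMap]
  simpa using Padic.norm_p (p := 2)

/-- `resid 2 = 0`: the residue ring has characteristic `2`. -/
theorem two_eq_zero_resid : (2 : Resid ℚ_[2] Ω) = 0 := by
  have h2 : (2 : Resid ℚ_[2] Ω) = resid ℚ_[2] Ω 2 := (map_ofNat (resid ℚ_[2] Ω) 2).symm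
  rw [h2, resid_eq_zero_iff]
  have hc : ((2 : ball ℚ_[2] Ω) : Ω) = 2 := by norm_cast
  rw [hc, spN_two]; norm_num

/-- In the residue ring, `-x = x`. -/
theorem neg_eq_self_resid (x : Resid ℚ_[2] Ω) : -x = x := by
  have h : x + x = 0 := by rw [← two_mul, two_eq_zero_resid, zero_mul]
  exact (neg_eq_of_add_eq_zero_left h)

/-- `‖I‖ = 1`. -/
theorem spN_I : spN ℚ_[2] D.I = 1 := by
  have h : spN ℚ_[2] D.I ^ 2 = 1 := by
    rw [← spN_pow, D.hI, spN_neg, spN_one]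
  have h0 := spN_nonneg ℚ_[2] D.I
  nlinarith [h, h0]

/-- `‖I - 1‖ < 1` (indeed `(I-1)² = -2I` has norm `1/2`). -/
theorem spN_I_sub_one_lt : spN ℚ_[2] (D.I - 1) < 1 := by
  have hsq : (D.I - 1) ^ 2 = -(2 * D.I) := by linear_combination D.hI
  have h : spN ℚ_[2] (D.I - 1) ^ 2 = 2⁻¹ := by
    rw [← spN_pow, hsq, spN_neg, spN_mul, spN_two, spN_I, mul_one]
  have h0 := spN_nonneg ℚ_[2] (D.I - 1)
  nlinarith [h, h0]

/-- `‖1 + I‖ < 1`. -/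
theorem spN_one_add_I_lt : spN ℚ_[2] (1 + D.I) < 1 := by
  have hsq : (1 + D.I) ^ 2 = 2 * D.I := by linear_combination D.hI
  have h : spN ℚ_[2] (1 + D.I) ^ 2 = 2⁻¹ := by
    rw [← spN_pow, hsq, spN_mul, spN_two, spN_I, mul_one]
  have h0 := spN_nonneg ℚ_[2] (1 + D.I)
  nlinarith [h, h0]

omit [Algebra.IsAlgebraic ℚ_[2] Ω] in
/-- `σ` commutes with the structure map. -/
theorem σ_ι (a : ℚ_[2]) : D.σ ((algebraMap ℚ_[2] Ω) a) = (algebraMap ℚ_[2] Ω) a := D.σ.commutes a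

omit [Algebra.IsAlgebraic ℚ_[2] Ω] in
/-- `τ` commutes with the structure map. -/
theorem τ_ι (a : ℚ_[2]) : D.τ ((algebraMap ℚ_[2] Ω) a) = (algebraMap ℚ_[2] Ω) a := D.τ.commutes a

/-- THE `ℤ₂[i]` LEMMA: if `‖a + b·I‖ ≤ 1` for `a, b ∈ ℚ₂` then `‖a‖ ≤ 1` and `‖b‖ ≤ 1`
(apply `σ`; `2a`, `2bI` and `a² + b²` have norm `≤ 1`; then sums of two squares mod `4`). -/
theorem norm_coeff_le_one {a b : ℚ_[2]} (h : spN ℚ_[2] ((algebraMap ℚ_[2] Ω) a + (algebraMap ℚ_[2] Ω) b * D.I) ≤ 1) : ‖a‖ ≤ 1 ∧ ‖b‖ ≤ 1 := by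
  have hσ : D.σ ((algebraMap ℚ_[2] Ω) a + (algebraMap ℚ_[2] Ω) b * D.I) = (algebraMap ℚ_[2] Ω) a - (algebraMap ℚ_[2] Ω) b * D.I := by
    rw [map_add, map_mul, σ_ι, σ_ι, D.σI]; ring
  have h' : spN ℚ_[2] ((algebraMap ℚ_[2] Ω) a - (algebraMap ℚ_[2] Ω) b * D.I) ≤ 1 := by rw [← hσ, spN_aut]; exact h
  have h2 : ‖(2 : ℚ_[2])‖ = 2⁻¹ := by simpa using Padic.norm_p (p := 2)
  -- sum: 2a
  have hsum : spN ℚ_[2] ((algebraMap ℚ_[2] Ω) (2 * a)) ≤ 1 := by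
    have : (algebraMap ℚ_[2] Ω) (2 * a) = ((algebraMap ℚ_[2] Ω) a + (algebraMap ℚ_[2] Ω) b * D.I) + ((algebraMap ℚ_[2] Ω) a - (algebraMap ℚ_[2] Ω) b * D.I) := by rw [map_mul, map_ofNat]; ring
    rw [this]; exact (spN_add_le ℚ_[2] _ _).trans (max_le h h')
  rw [spN_algebraMap, norm_mul, h2] at hsum
  have ha : ‖a‖ ≤ 2 := by
    have : (2⁻¹ : ℝ) * ‖a‖ ≤ 1 := hsum
    linarith
  -- difference: 2bI
  have hdiff : spN ℚ_[2] ((algebraMap ℚ_[2] Ω) (2 * b) * D.I) ≤ 1 := by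
    have : (algebraMap ℚ_[2] Ω) (2 * b) * D.I = ((algebraMap ℚ_[2] Ω) a + (algebraMap ℚ_[2] Ω) b * D.I) - ((algebraMap ℚ_[2] Ω) a - (algebraMap ℚ_[2] Ω) b * D.I) := by rw [map_mul, map_ofNat]; ring
    rw [this]; exact (spN_sub_le ℚ_[2] _ _).trans (max_le h h')
  rw [spN_mul, spN_I, mul_one, spN_algebraMap, norm_mul, h2] at hdiff
  have hb : ‖b‖ ≤ 2 := by
    have : (2⁻¹ : ℝ) * ‖b‖ ≤ 1 := hdiff
    linarith
  -- product: a² + b²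
  have hprod : spN ℚ_[2] ((algebraMap ℚ_[2] Ω) (a ^ 2 + b ^ 2)) ≤ 1 := by
    have : (algebraMap ℚ_[2] Ω) (a ^ 2 + b ^ 2) = ((algebraMap ℚ_[2] Ω) a + (algebraMap ℚ_[2] Ω) b * D.I) * ((algebraMap ℚ_[2] Ω) a - (algebraMap ℚ_[2] Ω) b * D.I) := by
      rw [map_add, map_pow, map_pow]; linear_combination ((algebraMap ℚ_[2] Ω) b) ^ 2 * D.hI
    rw [this, spN_mul]
    exact mul_le_one₀ h (spN_nonneg ℚ_[2] _) h'
  rw [spN_algebraMap] at hprod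
  exact TwoAdic.norm_le_one_of_sum_sq a b ha hb hprod

/-- Residues of `ℤ₂[i]`-type elements: if `‖a‖, ‖b‖ ≤ 1` then `x = a + b·I` satisfies `‖x‖ < 1` or `‖x - 1‖ < 1`,
i.e. its residue is `0` or `1` (because `I ≡ 1`). -/
theorem spN_lt_or_spN_sub_one_lt {a b : ℚ_[2]} (ha : ‖a‖ ≤ 1) (hb : ‖b‖ ≤ 1) :
    spN ℚ_[2] ((algebraMap ℚ_[2] Ω) a + (algebraMap ℚ_[2] Ω) b * D.I) < 1 ∨ spN ℚ_[2] ((algebraMap ℚ_[2] Ω) a + (algebraMap ℚ_[2] Ω) b * D.I - 1) < 1 := by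
  obtain ⟨εa, hεa, hεa'⟩ := TwoAdic.exists_rep_zero_one a ha
  obtain ⟨εb, hεb, hεb'⟩ := TwoAdic.exists_rep_zero_one b hb
  have hA : spN ℚ_[2] ((algebraMap ℚ_[2] Ω) (a - εa)) < 1 := by rw [spN_algebraMap]; exact hεa'
  have hB : spN ℚ_[2] ((algebraMap ℚ_[2] Ω) (b - εb) * D.I) < 1 := by rw [spN_mul, spN_I, mul_one, spN_algebraMap]; exact hεb'
  have hAB : spN ℚ_[2] ((algebraMap ℚ_[2] Ω) (a - εa) + (algebraMap ℚ_[2] Ω) (b - εb) * D.I) < 1 := (spN_add_le ℚ_[2] _ _).trans_lt (max_lt hA hB)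
  rcases hεa with rfl | rfl <;> rcases hεb with rfl | rfl
  · left
    have : (algebraMap ℚ_[2] Ω) a + (algebraMap ℚ_[2] Ω) b * D.I = (algebraMap ℚ_[2] Ω) (a - 0) + (algebraMap ℚ_[2] Ω) (b - 0) * D.I := by simp
    rw [this]; exact hAB
  · right
    have : (algebraMap ℚ_[2] Ω) a + (algebraMap ℚ_[2] Ω) b * D.I - 1 = ((algebraMap ℚ_[2] Ω) (a - 0) + (algebraMap ℚ_[2] Ω) (b - 1) * D.I) + (D.I - 1) := by
      rw [map_sub, map_sub, map_one, map_zero]; ring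
    rw [this]
    exact (spN_add_le ℚ_[2] _ _).trans_lt (max_lt hAB (spN_I_sub_one_lt D))
  · right
    have : (algebraMap ℚ_[2] Ω) a + (algebraMap ℚ_[2] Ω) b * D.I - 1 = (algebraMap ℚ_[2] Ω) (a - 1) + (algebraMap ℚ_[2] Ω) (b - 0) * D.I := by
      rw [map_sub, map_sub, map_one, map_zero]; ring
    rw [this]; exact hAB
  · left
    have : (algebraMap ℚ_[2] Ω) a + (algebraMap ℚ_[2] Ω) b * D.I = ((algebraMap ℚ_[2] Ω) (a - 1) + (algebraMap ℚ_[2] Ω) (b - 1) * D.I) + (1 + D.I) := by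
      rw [map_sub, map_sub, map_one]; ring
    rw [this]
    exact (spN_add_le ℚ_[2] _ _).trans_lt (max_lt hAB (spN_one_add_I_lt D))

/-- Residue form of the previous lemma: for `x = a + b·I` in the unit ball with `a, b ∈ ℚ₂`, `resid x ∈ {0, 1}`. -/
theorem resid_zero_or_one {a b : ℚ_[2]} (hx : (algebraMap ℚ_[2] Ω) a + (algebraMap ℚ_[2] Ω) b * D.I ∈ ball ℚ_[2] Ω) :
    resid ℚ_[2] Ω ⟨(algebraMap ℚ_[2] Ω) a + (algebraMap ℚ_[2] Ω) b * D.I, hx⟩ = 0 ∨ resid ℚ_[2] Ω ⟨(algebraMap ℚ_[2] Ω) a + (algebraMap ℚ_[2] Ω) b * D.I, hx⟩ = 1 := by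
  obtain ⟨ha, hb⟩ := norm_coeff_le_one D hx
  rcases spN_lt_or_spN_sub_one_lt D ha hb with h0 | h1
  · left; rw [resid_eq_zero_iff]; exact h0
  · right
    rw [← map_one (resid ℚ_[2] Ω), resid_eq_iff]
    simpa using h1

/-! ## Unit steps -/

/-- The set of UNIT STEPS: `u = X + I·Y` with `X = a + b·s3`, `Y = c + d·s3` (`a b c d ∈ ℚ₂`) and `X² + Y² = 1`
(the differences of adjacent vertices of a unit-distance graph with coordinates in `ℚ(√3, √11)`). -/
def unitSteps : Set Ω :=
  {u | ∃ a b c d : ℚ_[2], u = ((algebraMap ℚ_[2] Ω) a + (algebraMap ℚ_[2] Ω) b * D.s3) + D.I * ((algebraMap ℚ_[2] Ω) c + (algebraMap ℚ_[2] Ω) d * D.s3) ∧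
    ((algebraMap ℚ_[2] Ω) a + (algebraMap ℚ_[2] Ω) b * D.s3) ^ 2 + ((algebraMap ℚ_[2] Ω) c + (algebraMap ℚ_[2] Ω) d * D.s3) ^ 2 = 1}

/-- A unit step has spectral norm exactly `1` (MOSER-FIELD.md step (B): `u·σu = 1`, `‖σu‖ = ‖u‖`). -/
theorem spN_unitStep {u : Ω} (hu : u ∈ unitSteps D) : spN ℚ_[2] u = 1 := by
  obtain ⟨a, b, c, d, rfl, h⟩ := hu
  set X := (algebraMap ℚ_[2] Ω) a + (algebraMap ℚ_[2] Ω) b * D.s3 with hX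
  set Y := (algebraMap ℚ_[2] Ω) c + (algebraMap ℚ_[2] Ω) d * D.s3 with hY
  have hσX : D.σ X = X := by rw [hX, map_add, map_mul, σ_ι, σ_ι, D.σs3]
  have hσY : D.σ Y = Y := by rw [hY, map_add, map_mul, σ_ι, σ_ι, D.σs3]
  have hσu : D.σ (X + D.I * Y) = X - D.I * Y := by
    rw [map_add, map_mul, hσX, hσY, D.σI]; ring
  have hprod : (X + D.I * Y) * D.σ (X + D.I * Y) = 1 := by
    rw [hσu]; linear_combination h + (-(Y ^ 2)) * D.hI
  have hn : spN ℚ_[2] (X + D.I * Y) * spN ℚ_[2] (X + D.I * Y) = 1 := by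
    have := congrArg (spN ℚ_[2]) hprod
    rwa [spN_mul, spN_aut, spN_one] at this
  have h0 := spN_nonneg ℚ_[2] (X + D.I * Y)
  nlinarith [hn, h0]

/-- A unit step lies in the unit ball. -/
theorem unitStep_mem_ball {u : Ω} (hu : u ∈ unitSteps D) : u ∈ ball ℚ_[2] Ω := by
  rw [mem_ball_iff, spN_unitStep D hu]

omit [Algebra.IsAlgebraic ℚ_[2] Ω] in
/-- The negative of a unit step is a unit step. -/
theorem neg_mem_unitSteps {u : Ω} (hu : u ∈ unitSteps D) : -u ∈ unitSteps D := by
  obtain ⟨a, b, c, d, rfl, h⟩ := hu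
  refine ⟨-a, -b, -c, -d, ?_, ?_⟩
  · simp only [map_neg]; ring
  · simp only [map_neg]; linear_combination h

/-- MAIN LOCAL LEMMA (MOSER-FIELD.md (C) made residue-field-free): the residue of a unit step is a cube root of
unity.  Proof: `T = u + τu = 2a + 2c·I` and `N = u·τu ∈ ℚ₂ ⊕ ℚ₂·I` lie in the unit ball (`‖τu‖ = ‖u‖ = 1`), so
their residues are `0` or `1`, and `N̄ ≠ 0`; from `u² − Tu + N = 0` we get `ū² + T̄ū + 1 = 0` in characteristic
`2`, whence `ū³ = 1` in both cases `T̄ = 0, 1`. -/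
theorem resid_unitStep_cube {u : Ω} (hu : u ∈ unitSteps D) :
    resid ℚ_[2] Ω ⟨u, unitStep_mem_ball D hu⟩ ^ 3 = 1 := by
  have hmem := unitStep_mem_ball D hu
  have hnu := spN_unitStep D hu
  obtain ⟨a, b, c, d, hu_eq, h⟩ := hu
  -- τ u
  have hτu : D.τ u = ((algebraMap ℚ_[2] Ω) a - (algebraMap ℚ_[2] Ω) b * D.s3) + D.I * ((algebraMap ℚ_[2] Ω) c - (algebraMap ℚ_[2] Ω) d * D.s3) := by
    rw [hu_eq, map_add, map_mul, map_add, map_add, map_mul, map_mul, τ_ι, τ_ι, τ_ι, τ_ι, D.τI, D.τs3]; ring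
  -- T and N
  set T : Ω := u + D.τ u with hT
  set N : Ω := u * D.τ u with hN
  have hT_eq : T = (algebraMap ℚ_[2] Ω) (2 * a) + (algebraMap ℚ_[2] Ω) (2 * c) * D.I := by
    rw [hT, hτu, hu_eq, map_mul, map_mul, map_ofNat]; ring
  have hN_eq : N = (algebraMap ℚ_[2] Ω) (a ^ 2 - 3 * b ^ 2 - c ^ 2 + 3 * d ^ 2) + (algebraMap ℚ_[2] Ω) (2 * a * c - 6 * b * d) * D.I := by
    rw [hN, hτu, hu_eq]
    simp only [map_add, map_sub, map_mul, map_pow, map_ofNat]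
    linear_combination (-((algebraMap ℚ_[2] Ω) b) ^ 2 - 2 * ((algebraMap ℚ_[2] Ω) b) * ((algebraMap ℚ_[2] Ω) d) * D.I + ((algebraMap ℚ_[2] Ω) d) ^ 2) * D.hs3 +
      (((algebraMap ℚ_[2] Ω) c) ^ 2 - ((algebraMap ℚ_[2] Ω) d) ^ 2 * D.s3 ^ 2) * D.hI
  have hnτ : spN ℚ_[2] (D.τ u) = 1 := by rw [spN_aut]; exact hnu
  have hT_le : spN ℚ_[2] T ≤ 1 := by
    rw [hT]; exact (spN_add_le ℚ_[2] _ _).trans (max_le hnu.le hnτ.le)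
  have hN_one : spN ℚ_[2] N = 1 := by rw [hN, spN_mul, hnu, hnτ, mul_one]
  have hTmem : (algebraMap ℚ_[2] Ω) (2 * a) + (algebraMap ℚ_[2] Ω) (2 * c) * D.I ∈ ball ℚ_[2] Ω := by rw [← hT_eq]; exact hT_le
  have hNmem : (algebraMap ℚ_[2] Ω) (a ^ 2 - 3 * b ^ 2 - c ^ 2 + 3 * d ^ 2) + (algebraMap ℚ_[2] Ω) (2 * a * c - 6 * b * d) * D.I ∈ ball ℚ_[2] Ω := by
    rw [← hN_eq, mem_ball_iff, hN_one]
  -- residues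
  set ub : ball ℚ_[2] Ω := ⟨u, hmem⟩ with hub
  set Tb : ball ℚ_[2] Ω := ⟨_, hTmem⟩ with hTb
  set Nb : ball ℚ_[2] Ω := ⟨_, hNmem⟩ with hNb
  have hrel : ub ^ 2 - Tb * ub + Nb = 0 := by
    apply Subtype.ext
    change u ^ 2 - ((algebraMap ℚ_[2] Ω) (2 * a) + (algebraMap ℚ_[2] Ω) (2 * c) * D.I) * u +
      ((algebraMap ℚ_[2] Ω) (a ^ 2 - 3 * b ^ 2 - c ^ 2 + 3 * d ^ 2) + (algebraMap ℚ_[2] Ω) (2 * a * c - 6 * b * d) * D.I) = (0 : Ω)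
    rw [← hT_eq, ← hN_eq, hT, hN]; ring
  have hT01 := resid_zero_or_one D hTmem
  have hN01 := resid_zero_or_one D hNmem
  have hN_ne : resid ℚ_[2] Ω Nb ≠ 0 := resid_ne_zero_of_spN_eq_one ℚ_[2] (by
    change spN ℚ_[2] ((algebraMap ℚ_[2] Ω) (a ^ 2 - 3 * b ^ 2 - c ^ 2 + 3 * d ^ 2) + (algebraMap ℚ_[2] Ω) (2 * a * c - 6 * b * d) * D.I) = 1
    rw [← hN_eq]; exact hN_one)
  have hN1 : resid ℚ_[2] Ω Nb = 1 := by
    rcases hN01 with h0 | h1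
    · exact absurd h0 hN_ne
    · exact h1
  have key := congrArg (resid ℚ_[2] Ω) hrel
  rw [map_add, map_sub, map_mul, map_pow, map_zero, hN1] at key
  set x := resid ℚ_[2] Ω ub with hx
  -- key : x ^ 2 - resid Tb * x + 1 = 0
  rcases hT01 with h0 | h1
  · rw [h0, zero_mul, sub_zero] at key
    -- x² + 1 = 0 ⇒ (x + 1)² = 0 ⇒ x = -1 = 1
    have hsq : (x + 1) ^ 2 = 0 := by
      have : (x + 1) ^ 2 = x ^ 2 + 1 + 2 * x := by ring
      rw [this, key, two_eq_zero_resid, zero_mul, add_zero]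
    have hx1 : x + 1 = 0 := pow_eq_zero_iff (by norm_num) |>.1 hsq
    have hx' : x = 1 := by
      have := eq_neg_of_add_eq_zero_left hx1
      rw [this, neg_eq_self_resid]
    rw [hx', one_pow]
  · rw [h1, one_mul] at key
    -- x² - x + 1 = 0 ⇒ x³ = -1 = 1
    have h3 : x ^ 3 + 1 = (x + 1) * (x ^ 2 - x + 1) := by ring
    rw [key, mul_zero] at h3
    rw [eq_neg_of_add_eq_zero_left h3, neg_eq_self_resid]

/-- The residue of a unit step is nonzero. -/
theorem resid_unitStep_ne_zero {u : Ω} (hu : u ∈ unitSteps D) :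
    resid ℚ_[2] Ω ⟨u, unitStep_mem_ball D hu⟩ ≠ 0 :=
  resid_ne_zero_of_spN_eq_one ℚ_[2] (spN_unitStep D hu)

/-! ## The colour set `{x : x⁴ = x}` of the residue domain -/

variable (Ω) in
/-- The colour set of the residue ring: `{x : x⁴ = x}` (i.e. `F₄ ∩ k`, without naming the residue field `k`). -/
def quartFixed : Set (Resid ℚ_[2] Ω) := {x | x ^ 4 = x}

/-- Membership in the colour set. -/
theorem mem_quartFixed_iff {x : Resid ℚ_[2] Ω} : x ∈ quartFixed Ω ↔ x ^ 4 = x := Iff.rfl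

/-- `0` is a colour. -/
theorem zero_mem_quartFixed : (0 : Resid ℚ_[2] Ω) ∈ quartFixed Ω := by
  simp [mem_quartFixed_iff]

/-- Cube roots of unity are colours. -/
theorem mem_quartFixed_of_cube {x : Resid ℚ_[2] Ω} (h : x ^ 3 = 1) : x ∈ quartFixed Ω := by
  rw [mem_quartFixed_iff]
  calc x ^ 4 = x ^ 3 * x := by ring
    _ = x := by rw [h, one_mul]

/-- In characteristic `2`, `(x + y)² = x² + y²`. -/
theorem add_sq_resid (x y : Resid ℚ_[2] Ω) : (x + y) ^ 2 = x ^ 2 + y ^ 2 := by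
  have : (x + y) ^ 2 = x ^ 2 + y ^ 2 + 2 * (x * y) := by ring
  rw [this, two_eq_zero_resid, zero_mul, add_zero]

/-- The colour set is closed under addition (Frobenius). -/
theorem add_mem_quartFixed {x y : Resid ℚ_[2] Ω} (hx : x ∈ quartFixed Ω) (hy : y ∈ quartFixed Ω) :
    x + y ∈ quartFixed Ω := by
  rw [mem_quartFixed_iff] at *
  calc (x + y) ^ 4 = ((x + y) ^ 2) ^ 2 := by ring
    _ = x ^ 4 + y ^ 4 := by rw [add_sq_resid, add_sq_resid]; ring
    _ = x + y := by rw [hx, hy]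

/-- The colour set has at most four elements: it is contained in the root set of `X⁴ − X` over a domain. -/
theorem exists_finset_quartFixed :
    ∃ F : Finset (Resid ℚ_[2] Ω), F.card ≤ 4 ∧ ∀ x ∈ quartFixed Ω, x ∈ F := by
  classical
  set P : Polynomial (Resid ℚ_[2] Ω) := X ^ 4 - X with hP
  have hP0 : P ≠ 0 := by
    intro h
    have := congrArg (fun q : Polynomial (Resid ℚ_[2] Ω) => q.coeff 4) h
    simp [hP, coeff_X] at this
  have hdeg : P.natDegree ≤ 4 := by
    rw [hP]
    refine (natDegree_sub_le _ _).trans ?_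
    rw [natDegree_X_pow]
    exact max_le le_rfl (natDegree_X_le.trans (by norm_num))
  refine ⟨P.roots.toFinset, ?_, ?_⟩
  · exact (Multiset.toFinset_card_le _).trans ((Polynomial.card_roots' P).trans hdeg)
  · intro x hx
    rw [mem_quartFixed_iff] at hx
    rw [Multiset.mem_toFinset, mem_roots hP0, IsRoot.def, hP, eval_sub, eval_pow, eval_X]
    exact sub_eq_zero.2 hx

end Summit.Ventures.DiscreteObjects.UnitDistance.MoserLocal
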